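import Mathlib

/-!
# Crux `FermionizationDimension.ClassTransfer` (stmt-ValiantsHypothesis-7287), line `birth` —
# stub `stub_cheapConeRealisable`: the cheap cone of level `D` on `S_n` is realised by ONE
# commutative algebra of dimension `≤ (n+2)^(2D+1)`

The algebraic half of the line (CheapConeSmall).  For an arbitrary coefficient table `a k S τ`
(`k ≤ n`, `S ⊆ Fin n` with `|S| ≤ D`, `τ ∈ S_n`) the CONE FUNCTION
`f(σ) = Σ_{k ≤ n} Σ_{|S| ≤ D} Σ_τ [c₁(σ) = k ∧ σ|_S = τ|_S] · a k S τ` (`c₁` = number of fixed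
points) is realised multiplicatively, `ℓ(∏_i u_{σ(i),i}) = f(σ)`, by a commutative `ℂ`-algebra `R`
with `finrank_ℂ R ≤ (n+2)^(2D+1)`, elements `u_ab ∈ R` and a linear functional `ℓ : R → ℂ`.

Construction (semisimple — the function algebra on a finite set; easier to formalise than the
truncated polynomial algebra `ℂ[ε]/(ε^{n+1}) ⊗ ℂ[η]_{≤ D}` of the line card, same dimension count).
Take `R = Ω → ℂ` with `Ω = Fin (n+1) × (Fin D → Option (Fin n × Fin n))` (a sample node `t ≤ n`
times a word of at most `D` matrix positions), so `finrank R = |Ω| = (n+1)(n²+1)^D ≤ (n+2)^(2D+1)`,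
and put `u_ab (t, w) = (t if a = b, else 1) · [every letter (b, a') of w in column b has a' = a]`.
Then `(∏_i u_{σ(i),i})(t, w) = t^{c₁(σ)} · [w ⊆ graph σ]` (`w ⊆ graph σ`: every letter `(j, j')`
of `w` has `σ j = j'`).  The functional is `ℓ(r) = Σ_ω c(ω) r(ω)` with
`c(t, w) = Σ_{k ≤ n} W_{k t} · B_k(w)`, where
* `W = V⁻¹` inverts the Vandermonde matrix `V_{t j} = t^j` on the nodes `0, 1, …, n`
  (`Matrix.det_vandermonde_ne_zero_iff`, `Matrix.nonsing_inv_mul`), so that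
  `Σ_t W_{k t} t^m = [k = m]` for `m ≤ n` isolates `m = c₁(σ)`;
* `B_k(w) = Σ_{|S| ≤ D} Σ_τ [w = enc(S, τ)] · a k S τ` is a sum of point masses at encoding words
  `enc(S, τ)` listing the graph of `τ|_S` (they exist because `|S| ≤ D`, `Finset.orderIsoOfFin`),
  for which `enc(S, τ) ⊆ graph σ ↔ σ|_S = τ|_S`.
Summing out `t` and then `w` gives exactly the cone expansion.  The statement is elementary linear
algebra over Mathlib (the counting algebras behind the easy immanants: Hartmann 1985;
Bürgisser 2000, *The computational complexity of immanants*); no definitions are introduced (all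
data are local terms of the proof), and nothing here refers to `VP` — the composition
`ClassTransfer_of` of the line feeds it the level `D = (log₂ n + c)^c`.
-/

noncomputable section

-- `Summit.ValiantsHypothesis.ValiantsHypothesis.…` is the tree's mandated single-conjunct layout
-- (Sub = Summit), so the duplicated namespace component is intended.
set_option linter.dupNamespace false

namespace Summit.ValiantsHypothesis.ValiantsHypothesis.Theorems.FermionizationDimensionClassTransfer

open Finset

namespace CheapConeRealisable

/-- The dimension count `|Ω| = (n+1)(n²+1)^D ≤ (n+2)^(2D+1)`. [folklore] -/
theorem card_bound (n D : ℕ) : (n + 1) * (n * n + 1) ^ D ≤ (n + 2) ^ (2 * D + 1) := by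
  have h1 : n * n + 1 ≤ (n + 2) ^ 2 := by nlinarith
  calc (n + 1) * (n * n + 1) ^ D ≤ (n + 2) * ((n + 2) ^ 2) ^ D :=
        Nat.mul_le_mul (by omega) (Nat.pow_le_pow_left h1 D)
    _ = (n + 2) ^ (2 * D + 1) := by rw [← pow_mul, ← pow_succ']

/-- Inverting the Vandermonde matrix on the nodes `0, 1, …, n`: there are weights `W k t ∈ ℂ` with
`Σ_t W k t · t^j = [k = j]` for all `k, j ≤ n`. [folklore] -/
theorem exists_vandermonde_inv (n : ℕ) :
    ∃ W : Fin (n + 1) → Fin (n + 1) → ℂ, ∀ k j : Fin (n + 1),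
      ∑ t : Fin (n + 1), W k t * ((t : ℕ) : ℂ) ^ (j : ℕ) = if k = j then 1 else 0 := by
  let v : Fin (n + 1) → ℂ := fun i => ((i : ℕ) : ℂ)
  have hv : Function.Injective v := fun i j h => Fin.ext (Nat.cast_injective (R := ℂ) h)
  have hdet : IsUnit (Matrix.vandermonde v).det :=
    isUnit_iff_ne_zero.2 (Matrix.det_vandermonde_ne_zero_iff.2 hv)
  refine ⟨fun k t => (Matrix.vandermonde v)⁻¹ k t, fun k j => ?_⟩
  have h := congr_fun (congr_fun (Matrix.nonsing_inv_mul (Matrix.vandermonde v) hdet) k) j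
  rw [Matrix.mul_apply, Matrix.one_apply] at h
  simpa only [Matrix.vandermonde_apply, v] using h

/-- Encoding words: for `|S| ≤ D` there is a word `w : Fin D → Option (Fin n × Fin n)` listing the
graph of `τ|_S`, so that every letter `(j, j')` of `w` satisfies `σ j = j'` iff `σ|_S = τ|_S`.
(For `|S| > D` the statement is vacuous.) [folklore] -/
theorem exists_word (n D : ℕ) (S : Finset (Fin n)) (τ : Equiv.Perm (Fin n)) :
    ∃ w : Fin D → Option (Fin n × Fin n), S.card ≤ D →
      ∀ σ : Equiv.Perm (Fin n), (∀ d, ∀ e ∈ w d, σ e.1 = e.2) ↔ ∀ i ∈ S, σ i = τ i := by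
  by_cases hD : S.card ≤ D
  · let x : Fin S.card → Fin n := fun d => ((S.orderIsoOfFin rfl d : S) : Fin n)
    have hxmem : ∀ d, x d ∈ S := fun d => (S.orderIsoOfFin rfl d).2
    refine ⟨fun d => if hd : (d : ℕ) < S.card then some (x ⟨d, hd⟩, τ (x ⟨d, hd⟩)) else none,
      fun _ σ => ⟨fun h i hi => ?_, fun h d e he => ?_⟩⟩
    · set d' : Fin S.card := (S.orderIsoOfFin rfl).symm ⟨i, hi⟩ with hd'
      have hx : x d' = i := by
        show ((S.orderIsoOfFin rfl ((S.orderIsoOfFin rfl).symm ⟨i, hi⟩) : S) : Fin n) = i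
        rw [OrderIso.apply_symm_apply]
      have hlt : (d' : ℕ) < D := lt_of_lt_of_le d'.2 hD
      have h' := h ⟨d', hlt⟩ (x d', τ (x d')) (by simp [d'.2])
      simpa only [hx] using h'
    · by_cases hd : (d : ℕ) < S.card
      · simp only [hd, dite_true, Option.mem_def, Option.some.injEq] at he
        subst he
        exact h _ (hxmem _)
      · simp [hd] at he
  · exact ⟨fun _ => none, fun h => absurd h hD⟩

/-- Summing out the Vandermonde coordinate: if `Σ_t W k t · p t = [k = k₀]`, then the weights
`c (t, w) = Σ_k W k t · B k w` integrate `p ⊗ P` to `Σ_w B k₀ w · P w`. [folklore] -/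
theorem sum_weights_mul {T X : Type*} [Fintype T] [DecidableEq T] [Fintype X]
    (W : T → T → ℂ) (p : T → ℂ) (k₀ : T) (hW : ∀ k, ∑ t, W k t * p t = if k = k₀ then 1 else 0)
    (B : T → X → ℂ) (P : X → ℂ) :
    ∑ ω : T × X, (∑ k, W k ω.1 * B k ω.2) * (p ω.1 * P ω.2) = ∑ w, B k₀ w * P w := by
  rw [Fintype.sum_prod_type_right]
  refine Fintype.sum_congr _ _ fun w => ?_
  calc ∑ t, (∑ k, W k t * B k w) * (p t * P w)
      = ∑ t, ∑ k, W k t * B k w * (p t * P w) := by simp_rw [Finset.sum_mul]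
    _ = ∑ k, ∑ t, W k t * B k w * (p t * P w) := Finset.sum_comm
    _ = ∑ k, B k w * P w * ∑ t, W k t * p t := by
        refine Finset.sum_congr rfl fun k _ => ?_
        rw [Finset.mul_sum]
        exact Finset.sum_congr rfl fun t _ => by ring
    _ = B k₀ w * P w := by
        simp_rw [hW, mul_ite, mul_one, mul_zero]
        exact Fintype.sum_ite_eq' k₀ _

/-- Summing out the word coordinate against a sum of point masses at the encodings. [folklore] -/
theorem sum_pointMass_mul {X α β : Type*} [Fintype X] [DecidableEq X] [Fintype β] (s : Finset α)
    (enc : α → β → X) (a : α → β → ℂ) (cond : X → Prop) [DecidablePred cond] :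
    ∑ w : X, (∑ S ∈ s, ∑ τ : β, if w = enc S τ then a S τ else 0) * (if cond w then 1 else 0)
      = ∑ S ∈ s, ∑ τ : β, if cond (enc S τ) then a S τ else 0 := by
  calc ∑ w : X, (∑ S ∈ s, ∑ τ : β, if w = enc S τ then a S τ else 0) * (if cond w then 1 else 0)
      = ∑ w : X, ∑ S ∈ s, ∑ τ : β,
          (if w = enc S τ then a S τ else 0) * (if cond w then 1 else 0) := by
        simp_rw [Finset.sum_mul]
    _ = ∑ S ∈ s, ∑ w : X, ∑ τ : β,
          (if w = enc S τ then a S τ else 0) * (if cond w then 1 else 0) := Finset.sum_comm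
    _ = ∑ S ∈ s, ∑ τ : β, ∑ w : X,
          (if w = enc S τ then a S τ else 0) * (if cond w then 1 else 0) :=
        Finset.sum_congr rfl fun _ _ => Finset.sum_comm
    _ = ∑ S ∈ s, ∑ τ : β, if cond (enc S τ) then a S τ else 0 := by
        refine Finset.sum_congr rfl fun S _ => Finset.sum_congr rfl fun τ _ => ?_
        simp_rw [ite_mul, zero_mul]
        rw [Fintype.sum_ite_eq']
        simp only [mul_ite, mul_one, mul_zero]

/-- Reshuffling the cone expansion: the sum over the fixed-point count `k < N` collapses at
`k = m` when `m < N`. [folklore] -/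
theorem cone_sum_collapse {α β : Type*} [Fintype β] (s : Finset α) (N m : ℕ) (hm : m < N)
    (a : ℕ → α → β → ℂ) (Q : α → β → Prop) [∀ S τ, Decidable (Q S τ)] :
    ∑ k ∈ range N, ∑ S ∈ s, ∑ τ : β, (if m = k ∧ Q S τ then a k S τ else 0)
      = ∑ S ∈ s, ∑ τ : β, if Q S τ then a m S τ else 0 := by
  rw [Finset.sum_comm]
  refine Finset.sum_congr rfl fun S _ => ?_
  rw [Finset.sum_comm]
  refine Finset.sum_congr rfl fun τ _ => ?_
  simp_rw [ite_and]
  rw [Finset.sum_ite_eq, if_pos (Finset.mem_range.2 hm)]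

end CheapConeRealisable

open CheapConeRealisable in
/-- **CheapConeSmall** (stub `stub_cheapConeRealisable` of line `birth`, signature verbatim): every
function in the cheap cone of level `D` on `S_n` — given by an arbitrary coefficient table
`a k S τ` — is realised multiplicatively, `ℓ(∏_i u_{σ(i),i}) = Σ_k Σ_{|S| ≤ D} Σ_τ
[c₁(σ) = k ∧ σ|_S = τ|_S] · a k S τ`, by ONE commutative `ℂ`-algebra of dimension
`≤ (n+2)^(2D+1)`, namely the function algebra `ℂ^Ω` on
`Ω = Fin (n+1) × (Fin D → Option (Fin n × Fin n))` (Vandermonde weights in the first coordinate,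
point masses at encoding words in the second).
[folklore] -/
theorem stub_cheapConeRealisable :
    ∀ (n D : ℕ) (a : ℕ → Finset (Fin n) → Equiv.Perm (Fin n) → ℂ),
      ∃ (R : Type) (_ : CommRing R) (_ : Algebra ℂ R) (_ : Module.Finite ℂ R)
        (u : Fin n → Fin n → R) (ℓ : R →ₗ[ℂ] ℂ),
        Module.finrank ℂ R ≤ (n + 2) ^ (2 * D + 1) ∧
        ∀ σ : Equiv.Perm (Fin n), ℓ (∏ i, u (σ i) i) =
          ∑ k ∈ Finset.range (n + 1),
            ∑ S ∈ (Finset.univ : Finset (Finset (Fin n))).filter (fun S => S.card ≤ D),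
              ∑ τ : Equiv.Perm (Fin n),
                if (Finset.univ.filter fun i : Fin n => σ i = i).card = k ∧ (∀ i ∈ S, σ i = τ i)
                then a k S τ else 0 := by
  intro n D a
  -- the encoding words and the Vandermonde weights
  choose enc henc using exists_word n D
  obtain ⟨W, hW⟩ := exists_vandermonde_inv n
  -- the data: `R = Ω → ℂ`, the elements `u a' b`, the weights `c` of the functional `ℓ`
  let X := Fin D → Option (Fin n × Fin n)
  let Ω := Fin (n + 1) × X
  let filt : Finset (Finset (Fin n)) := Finset.univ.filter fun S => S.card ≤ D
  let B : Fin (n + 1) → X → ℂ := fun k w =>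
    ∑ S ∈ filt, ∑ τ : Equiv.Perm (Fin n), if w = enc S τ then a k S τ else 0
  let c : Ω → ℂ := fun ω => ∑ k, W k ω.1 * B k ω.2
  let u : Fin n → Fin n → Ω → ℂ := fun a' b ω =>
    (if a' = b then ((ω.1 : ℕ) : ℂ) else 1) *
      (if ∀ d, ∀ e ∈ ω.2 d, e.1 = b → a' = e.2 then 1 else 0)
  let ℓ : (Ω → ℂ) →ₗ[ℂ] ℂ :=
    { toFun := fun r => ∑ ω, c ω * r ω
      map_add' := fun r r' => by
        simp only [Pi.add_apply, mul_add, Finset.sum_add_distrib]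
      map_smul' := fun z r => by
        simp only [Pi.smul_apply, smul_eq_mul, RingHom.id_apply, Finset.mul_sum]
        exact Finset.sum_congr rfl fun ω _ => by ring }
  refine ⟨Ω → ℂ, inferInstance, inferInstance, inferInstance, u, ℓ, ?_, fun σ => ?_⟩
  · -- dimension count
    calc Module.finrank ℂ (Ω → ℂ) = Fintype.card Ω := Module.finrank_fintype_fun_eq_card ℂ
      _ = (n + 1) * (n * n + 1) ^ D := by
        simp only [Ω, X, Fintype.card_prod, Fintype.card_fin, Fintype.card_fun,
          Fintype.card_option]
      _ ≤ (n + 2) ^ (2 * D + 1) := card_bound n D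
  · -- the realisation identity
    set m : ℕ := (Finset.univ.filter fun i : Fin n => σ i = i).card
    have hm : m < n + 1 := by
      have h := Finset.card_filter_le (Finset.univ : Finset (Fin n)) (fun i : Fin n => σ i = i)
      rw [Finset.card_univ, Fintype.card_fin] at h
      exact Nat.lt_succ_of_le h
    -- Step 1: the product of the `u`'s is `t^{c₁ σ} · [w ⊆ graph σ]`
    have hprod : (∏ i, u (σ i) i) = fun ω : Ω =>
        ((ω.1 : ℕ) : ℂ) ^ m * (if ∀ d, ∀ e ∈ ω.2 d, σ e.1 = e.2 then 1 else 0) := by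
      funext ω
      rw [Finset.prod_apply]
      simp only [u]
      rw [Finset.prod_mul_distrib]
      congr 1
      · rw [← Finset.prod_filter, Finset.prod_const]
      · rw [Fintype.prod_boole]
        exact ite_congr
          (propext
            ⟨fun h d e he => h e.1 d e he rfl, fun h i d e he hi => by subst hi; exact h d e he⟩)
          (fun _ => rfl) (fun _ => rfl)
    -- Step 2: the Vandermonde weights isolate `m = c₁ σ`
    have hWm : ∀ k : Fin (n + 1),
        ∑ t, W k t * ((t : ℕ) : ℂ) ^ m = if k = ⟨m, hm⟩ then 1 else 0 :=
      fun k => hW k ⟨m, hm⟩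
    have hℓ : ∀ r : Ω → ℂ, ℓ r = ∑ ω, c ω * r ω := fun _ => rfl
    -- the indicator `[w ⊆ graph σ]` and the restriction predicate `σ|_S = τ|_S`
    let P : X → ℂ := fun w => if ∀ d, ∀ e ∈ w d, σ e.1 = e.2 then 1 else 0
    let Q : Finset (Fin n) → Equiv.Perm (Fin n) → Prop := fun S τ => ∀ i ∈ S, σ i = τ i
    calc ℓ (∏ i, u (σ i) i)
        = ∑ ω : Ω, c ω * (((ω.1 : ℕ) : ℂ) ^ m * P ω.2) := by rw [hℓ, hprod]
      _ = ∑ w : X, B ⟨m, hm⟩ w * P w :=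
          sum_weights_mul W (fun t : Fin (n + 1) => ((t : ℕ) : ℂ) ^ m) ⟨m, hm⟩ hWm B P
      _ = ∑ S ∈ filt, ∑ τ : Equiv.Perm (Fin n),
            if (∀ d, ∀ e ∈ enc S τ d, σ e.1 = e.2) then a m S τ else 0 :=
          sum_pointMass_mul filt enc (a m) (fun w : X => ∀ d, ∀ e ∈ w d, σ e.1 = e.2)
      _ = ∑ S ∈ filt, ∑ τ : Equiv.Perm (Fin n), if Q S τ then a m S τ else 0 :=
          Finset.sum_congr rfl fun S hS => Finset.sum_congr rfl fun τ _ =>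
            ite_congr (propext (henc S τ (Finset.mem_filter.1 hS).2 σ))
              (fun _ => rfl) (fun _ => rfl)
      _ = _ := (cone_sum_collapse filt (n + 1) m hm a Q).symm

end Summit.ValiantsHypothesis.ValiantsHypothesis.Theorems.FermionizationDimensionClassTransfer
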